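import Literature.MathematicalPhysics.QuantumFieldTheory.Balaban1983to89.B9Eq325ProjFormulaZdPer
import Literature.MathematicalPhysics.QuantumFieldTheory.Balaban1983to89.B9Eq325ProjContinuityZd

/-!
# `Balaban1983to89.B9Eq325ProjContinuityZdPer` — [Balaban1985BackgroundPropagators] (3.21)–(3.22), (3.25) p. 394 ON THE TORUS `T_P` READ ON `ℤᵈ`: the record's
# gauge-fixing projection `R(U₀)` on `L²(T_P, 𝔤)` (`B9Eq321LandauProjectionZdPer.projRPer`) DEPENDS CONTINUOUSLY ON THE BACKGROUND `U₀` on Hermitian inputs,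
# along any family of unitary periodic backgrounds with unitary averaged transporters in the regime of (3.25) — read off the explicit letters `Δ′_a(U₀)`,
# `G′(U₀)`, `Q′(U₀)`, `Q′(U₀)*`, `(Q′G′²Q′*)⁻¹(U₀)`, each a stencil continuous in `U₀` (the inverses by finite-dimensional inverse continuity); the periodic twin of
# `B9Eq325ProjContinuityZd`, fourth link of the (3.25) chain on the torus

statement-level skeleton of published theorems with citation tags; proofs where landed; nothing here is a claim about the
Yang–Mills mass gap

`[Balaban1985BackgroundPropagators]` ("B9", CMP **99** (1985) 389–434) p. 394 (3.21)–(3.25), p. 393 (3.19); Thm 3.11 p. 416 (the operators are invertible in the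
regime).  `[Balaban1985RegularSpaces]` p. 77 *«Ω_j = T_η»*.  PDF held: `paper:balaban1985-cmp99-background-propagators` pp. 393–395.

CITATION HEADER (lean-in-tree rule).  Cell `pub-ymgap` (YM Track A), DAG node N06 = [B9], width seat `pub-ymgap-dag-n06-w4` (g6), the (β′-PERIODIC) road.  WHY: the
openness engine `B9Thm311PosDefOpenZd.posDef_eventually_of_continuousWithinAt` (this lineage, g3) turns «the letters of `Δ_a(U₀)` are continuous in `U₀`» + «`Δ_a(1)` is
positive» into Thm 3.11 near the flat background; on the torus the only letter of dag-n06-b's genuine periodic record `opsAllZdPer` whose continuity is not a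
one-line stencil fact is `D R(U₀) D*` — THIS FILE gives the continuity of `R(U₀) = projRPer` in `U₀`.  Every generic tool is imported BY NAME from the Dirichlet
twin (`continuousAt_ofBijective_symm_apply`, `continuousAt_covLap`, `continuousAt_QprimeIter`, `continuousAt_conjR`, `continuousAt_bondVar`); nothing is re-declared.

WHAT IS PROVED (kernel, 0 sorry; theorems only — no `def`, no `instance`, no `notation`).  Along a family `U : Z → (ℤᵈ → bonds → 𝔸ˣ)` continuous at `z₀` whose
averaged transporters `Ū_zʲ(Γ_{y,x})`, `j ≤ m`, are continuous at `z₀`: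
* §1 `continuousAt_perSub_iff ∕ continuousAt_levPer_iff` (continuity in `L²(T_P)` ∕ `L²(𝔅_P)` = continuity of the values), `continuousAt_qprimeT1 ∕ continuousAt_QprimeT ∕
  continuousAt_QT` (the B8 transpose stencils are continuous in the background), ★ `continuousAt_deltaPrimeAPerFun_apply`, `continuousAt_deltaPrimeAPer`,
  ★★ `continuousAt_GpPer` (in the regime along the family), `continuousAt_QprimeVecPer`, `continuousAt_QprimeStarPer`, `continuousAt_qggqPer`, ★★ `continuousAt_cPer`
  (where `Q′G′²Q′*` is bijective along the family), ★★ `continuousAt_RopPer`.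
* §2 ★★★ `continuousAt_projRPer_of_herm` (THE RECORD's `R(U)` ON `L²(T_P, 𝔤)`, applied to a periodic Hermitian site function with continuous values, IS CONTINUOUS IN
  THE BACKGROUND along any family of unitary `P`-periodic backgrounds with unitary averaged transporters, `L ≥ 1`, `Lᵐ ∣ P`, level-periodic `Λ_j`, in the regime
  (`Δ′_a` invertible, `Q′*` injective), faithful Hermitian tracial `τ`, finite-dimensional fibre) and `continuousAt_covDerivFwd_projRPer_covDivB` (the `DRD*` letter
  `D^η_U R(U) D^{η*}_U A` of a periodic Hermitian bond field is continuous in the background).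

HONEST SCOPE.  Continuity bookkeeping + the Dirichlet twin's inverse-continuity lemma; no estimate of [B9]; the regime hypotheses are DISPLAYED along the family
(at `U₀ = 1` they hold by `B9Eq324DeltaPrimeAZdPer.regularPrimePer_one` and `B9Eq325QGGQInvZdPer.qprimeStarPerInjective_of_single_level`; their openness is the next
file's business).  Count-neutral; N05 ∕ N06 NOT discharged; K1⁹ `stmt-QuantumFields-27364` NOT closed; Theorem 3.11 at curved `U₀` NOT proved here; one finite `𝕋⁴`
programme at fixed `ε`, Bałaban as printed; R4 closes only the conditional finite-`𝕋⁴` rung `BalabanLadder.UV` — nothing continuum ∕ ℝ⁴ ∕ OS ∕ mass gap ∕ Clay.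
Unit `pub-ymgap-dag-n06-w4` (g6), 2026-08-28.
-/

noncomputable section

namespace Literature.MathematicalPhysics.QuantumFieldTheory.Balaban1983to89.B9Eq325ProjContinuityZdPer

open Filter Topology
open B7Prop1Explicit
open B7Prop2Explicit (unitaryUnits)
open B7Eq78Linearization (conjR QprimeIter zdBlocking)
open B8Eq119TwistedAxial (bgT)
open B8Ineq132 (covDerivFwd)
open B8Eq138LandauZd (covDivB covLap qprimeT1 QprimeT QT)
open T4TermwiseTorus (IsPeriodic tcls tlift)
open B9Eq321LandauProjectionZdPer (perSub projRPer)
open B9Eq324DeltaPrimeAZdPer (penaltyMult deltaPrimeAPerFun deltaPrimeAPerFun_apply deltaPrimeAPer deltaPrimeAPer_coe_apply GpPer RegularPrimePer)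
open B9Eq325QGGQInvZdPer (levPer QprimeVecPer QprimeVecPer_apply QprimeStarPer QprimeStarPer_coe qggqPer qggqPer_apply QprimeStarPerInjective cPer
  qggqPer_bijective finiteDimensional_levPer)
open B9Eq325ProjFormulaZdPer (RopPer coe_projRPer_eq_RopPer_of_herm)
open B9Eq325ProjContinuityZd (continuousAt_ofBijective_symm_apply continuousAt_covLap continuousAt_covDerivFwd continuousAt_covDivB continuousAt_QprimeIter)
open B7Eq43AveragingContinuity (continuousAt_conjR)

-- `Site` alone could resolve to the torus sites of `Setup.lean`; re-export the `ℤ^d` sites of `B7Prop1Explicit`.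
export B7Prop1Explicit (Site)

variable {d : ℕ} {𝔸 : Type*} [CStarAlgebra 𝔸] {Z : Type*} [TopologicalSpace Z] {z₀ : Z}

/-! ## §1  The letters of (3.25) on the torus are continuous in the background -/

section Letters

variable {P L : ℕ} {m : ℕ} {Λs : ℕ → Set (Site d)}

/-- a family in `L²(T_P, ·)` is continuous at `z₀` iff its site values are. [cite: Balaban1985BackgroundPropagators, (3.21) p.394 (bookkeeping)] -/
theorem continuousAt_perSub_iff {F : Z → perSub (𝔸 := 𝔸) (d := d) P} :
    ContinuousAt F z₀ ↔ ∀ x : Site d, ContinuousAt (fun z => (F z : Site d → 𝔸) x) z₀ := by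
  rw [Topology.IsInducing.subtypeVal.continuousAt_iff, continuousAt_pi]
  rfl

/-- a family in `L²(𝔅_P, ·)` is continuous at `z₀` iff its values are. [cite: Balaban1985BackgroundPropagators, (3.24) p.394 (bookkeeping)] -/
theorem continuousAt_levPer_iff {Φ : Z → levPer (𝔸 := 𝔸) (d := d) P L m Λs} :
    ContinuousAt Φ z₀ ↔ ∀ p : ℕ × Site d, ContinuousAt (fun z => (Φ z : ℕ × Site d → 𝔸) p) z₀ := by
  rw [Topology.IsInducing.subtypeVal.continuousAt_iff, continuousAt_pi]
  rfl

variable {U : Z → Site d → Fin d → 𝔸ˣ} (hU : ContinuousAt U z₀)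
variable (hbgT : ∀ j, j < m + 1 → ∀ (y x : Site d), ContinuousAt (fun z => bgT L (U z) j y x) z₀)

include hbgT in
/-- **THE ONE-STEP TRANSPOSE STENCIL IS CONTINUOUS IN THE BACKGROUND** (level `j ≤ m`; the transporter's inverse and the conjugation are continuous).
[cite: Balaban1985BackgroundPropagators, (3.19) p.393] -/
theorem continuousAt_qprimeT1 {j : ℕ} (hj : j < m + 1) {ν : Z → Site d → 𝔸} (hν : ∀ y : Site d, ContinuousAt (fun z => ν z y) z₀) (x : Site d) :
    ContinuousAt (fun z => qprimeT1 L (U z) j (ν z) x) z₀ := by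
  unfold qprimeT1
  exact (continuousAt_conjR (hbgT j hj _ x).inv (hν _)).const_smul _

include hbgT in
/-- **THE ITERATED TRANSPOSE STENCIL `Q′_j(U)ᵀν` IS CONTINUOUS IN THE BACKGROUND** (`j ≤ m`). [cite: Balaban1985BackgroundPropagators, (3.19) p.393, (3.24) p.394] -/
theorem continuousAt_QprimeT : ∀ (j : ℕ), j < m + 1 → ∀ {ν : Z → Site d → 𝔸}, (∀ y : Site d, ContinuousAt (fun z => ν z y) z₀) →
    ∀ x : Site d, ContinuousAt (fun z => QprimeT L (U z) j (ν z) x) z₀ := by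
  intro j
  induction j with
  | zero => intro _ ν hν x; exact hν x
  | succ j ih =>
    intro hj ν hν x
    show ContinuousAt (fun z => QprimeT L (U z) j (qprimeT1 L (U z) j (ν z)) x) z₀
    exact ih (Nat.lt_of_succ_lt hj) (fun y => continuousAt_qprimeT1 hbgT (Nat.lt_of_succ_lt_succ (Nat.lt_succ_of_lt hj)) hν y) x

include hbgT in
/-- **THE MULTIPLIER TRANSPOSE `Q′(U)ᵀμ` IS CONTINUOUS IN THE BACKGROUND** for level multipliers continuous at `z₀`. [cite: Balaban1985BackgroundPropagators, (3.24) p.394] -/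
theorem continuousAt_QT (Λ' : ℕ → Set (Site d)) {μ : Z → ℕ → Site d → 𝔸} (hμ : ∀ j, j < m + 1 → ∀ y : Site d, ContinuousAt (fun z => μ z j y) z₀) (x : Site d) :
    ContinuousAt (fun z => QT L m Λ' (U z) (μ z) x) z₀ := by
  unfold QT
  refine tendsto_finsetSum _ fun j hj => ?_
  have hj' : j < m + 1 := Finset.mem_range.1 hj
  refine continuousAt_QprimeT hbgT j hj' (fun y => ?_) x
  by_cases hy : y ∈ Λ' j
  · simp only [Set.indicator_of_mem hy]; exact hμ j hj' y
  · simp only [Set.indicator_of_notMem hy]; exact continuousAt_const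

variable (η : ℝ) (a : ℕ → ℝ)

include hU hbgT in
/-- ★ **(3.24) ON THE TORUS: `Δ′_a(U)f` OF A BACKGROUND-DEPENDENT SITE FUNCTION IS CONTINUOUS IN THE BACKGROUND.** [cite: Balaban1985BackgroundPropagators, (3.24) p.394] -/
theorem continuousAt_deltaPrimeAPerFun_apply {F : Z → Site d → 𝔸} (hF : ∀ y : Site d, ContinuousAt (fun z => F z y) z₀) (x : Site d) :
    ContinuousAt (fun z => deltaPrimeAPerFun L (U z) η m a Λs (F z) x) z₀ := by
  simp only [deltaPrimeAPerFun_apply]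
  refine (continuousAt_covLap hU η x hF).add (continuousAt_QT hbgT Λs (fun j hj y => ?_) x)
  simp only [penaltyMult]
  exact (continuousAt_QprimeIter (zdBlocking d L) hbgT hF j hj.le y).const_smul _

include hU hbgT in
/-- **`Δ′_a(U)` ON `L²(T_P, ·)` applied to a continuous family is continuous in the background.** [cite: Balaban1985BackgroundPropagators, (3.24) p.394] -/
theorem continuousAt_deltaPrimeAPer {F : Z → perSub (𝔸 := 𝔸) (d := d) P} (hF : ContinuousAt F z₀) :
    ContinuousAt (fun z => deltaPrimeAPer L (U z) η m a Λs P (F z)) z₀ := by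
  rw [continuousAt_perSub_iff] at hF ⊢
  intro x
  simp only [deltaPrimeAPer_coe_apply]
  exact continuousAt_deltaPrimeAPerFun_apply hU hbgT η a hF _

variable [NeZero P] [FiniteDimensional ℝ 𝔸]

include hU hbgT in
/-- ★★ **`G′(U) = (Δ′_a(U))⁻¹` ON `L²(T_P, ·)` APPLIED TO A CONTINUOUS FAMILY IS CONTINUOUS IN THE BACKGROUND**, along a family in the regime (the Dirichlet twin's
inverse-continuity lemma). [cite: Balaban1985BackgroundPropagators, (3.24) p.394 («Its inverse is denoted by G′, or G′(U)»), Thm 3.11 p.416] -/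
theorem continuousAt_GpPer (hreg : ∀ z, RegularPrimePer L (U z) η m a Λs P) {F : Z → perSub (𝔸 := 𝔸) (d := d) P} (hF : ContinuousAt F z₀) :
    ContinuousAt (fun z => GpPer L (U z) η m a Λs P (F z)) z₀ := by
  haveI := B9Eq321LandauProjectionZdPer.finiteDimensional_perSub (𝔸 := 𝔸) (d := d) P
  have h := continuousAt_ofBijective_symm_apply (fun z => deltaPrimeAPer L (U z) η m a Λs P) hreg
    (fun v => continuousAt_deltaPrimeAPer hU hbgT η a continuousAt_const) hF
  refine h.congr (Eventually.of_forall fun z => ?_)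
  show _ = GpPer L (U z) η m a Λs P (F z)
  rw [GpPer, dif_pos (hreg z)]
  rfl

include hbgT in
omit [NeZero P] [FiniteDimensional ℝ 𝔸] in
/-- **`Q′` applied to a continuous family of `L²(T_P, ·)` is continuous in the background.** [cite: Balaban1985BackgroundPropagators, (3.18)–(3.19) p.393] -/
theorem continuousAt_QprimeVecPer {F : Z → perSub (𝔸 := 𝔸) (d := d) P} (hF : ContinuousAt F z₀) :
    ContinuousAt (fun z => QprimeVecPer P L (U z) m Λs (F z)) z₀ := by
  classical
  rw [continuousAt_perSub_iff] at hF
  rw [continuousAt_levPer_iff]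
  intro p
  obtain ⟨j, y⟩ := p
  by_cases hp : j ≤ m ∧ B9Eq325QGGQInvZdPer.InSat P L Λs j y
  · have h := continuousAt_QprimeIter (zdBlocking d L) hbgT hF j (Nat.le_succ_of_le hp.1) (tlift (tcls (P / L ^ j) y))
    refine h.congr (Eventually.of_forall fun z => ?_)
    simp only [QprimeVecPer_apply, if_pos hp]
  · refine (continuousAt_const (y := (0 : 𝔸))).congr (Eventually.of_forall fun z => ?_)
    simp only [QprimeVecPer_apply, if_neg hp]

include hbgT in
omit [NeZero P] [FiniteDimensional ℝ 𝔸] in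
/-- **`Q′*` applied to a continuous family of `L²(𝔅_P, ·)` is continuous in the background** (transpose stencils with continuous transporters).
[cite: Balaban1985BackgroundPropagators, (3.25) p.394 («Q′*»)] -/
theorem continuousAt_QprimeStarPer {Φ : Z → levPer (𝔸 := 𝔸) (d := d) P L m Λs} (hΦ : ContinuousAt Φ z₀) :
    ContinuousAt (fun z => QprimeStarPer P L (U z) m Λs (Φ z)) z₀ := by
  rw [continuousAt_levPer_iff] at hΦ
  rw [continuousAt_perSub_iff]
  intro x
  simp only [QprimeStarPer_coe, B9Eq321LandauProjectionZdPer.perRestrict]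
  exact continuousAt_QT hbgT _ (fun j _ y => hΦ (j, y)) _

include hU hbgT in
/-- **`Q′G′(U)²Q′*` applied to a continuous family is continuous in the background** (in the regime along the family). [cite: Balaban1985BackgroundPropagators, (3.25) p.394] -/
theorem continuousAt_qggqPer (hreg : ∀ z, RegularPrimePer L (U z) η m a Λs P) {Φ : Z → levPer (𝔸 := 𝔸) (d := d) P L m Λs} (hΦ : ContinuousAt Φ z₀) :
    ContinuousAt (fun z => qggqPer P L (U z) η m a Λs (Φ z)) z₀ := by
  simp only [qggqPer_apply]
  exact continuousAt_QprimeVecPer hbgT (continuousAt_GpPer hU hbgT η a hreg (continuousAt_GpPer hU hbgT η a hreg (continuousAt_QprimeStarPer hbgT hΦ)))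

include hU hbgT in
/-- ★★ **`(Q′G′(U)²Q′*)⁻¹` APPLIED TO A CONTINUOUS FAMILY IS CONTINUOUS IN THE BACKGROUND**, where `Q′G′²Q′*` is bijective along the family (`Lᵐ ∣ P`).
[cite: Balaban1985BackgroundPropagators, (3.25) p.394, Thm 3.11 p.416] -/
theorem continuousAt_cPer (hP : L ^ m ∣ P) (hreg : ∀ z, RegularPrimePer L (U z) η m a Λs P)
    (hb : ∀ z, Function.Bijective (qggqPer (𝔸 := 𝔸) (d := d) P L (U z) η m a Λs)) {Φ : Z → levPer (𝔸 := 𝔸) (d := d) P L m Λs} (hΦ : ContinuousAt Φ z₀) :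
    ContinuousAt (fun z => cPer P L (U z) η m a Λs (Φ z)) z₀ := by
  haveI := finiteDimensional_levPer (𝔸 := 𝔸) (d := d) P L m Λs hP
  have h := continuousAt_ofBijective_symm_apply (fun z => qggqPer P L (U z) η m a Λs) hb
    (fun v => continuousAt_qggqPer hU hbgT η a hreg continuousAt_const) hΦ
  refine h.congr (Eventually.of_forall fun z => ?_)
  show _ = cPer P L (U z) η m a Λs (Φ z)
  rw [cPer, dif_pos (hb z)]
  rfl

include hU hbgT in
/-- ★★ **(3.25) `R(U)f = f − G′Q′*(Q′G′²Q′*)⁻¹Q′G′f` ON `L²(T_P, ·)` APPLIED TO A CONTINUOUS FAMILY IS CONTINUOUS IN THE BACKGROUND** (regime along the family).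
[cite: Balaban1985BackgroundPropagators, (3.25) p.394] -/
theorem continuousAt_RopPer (hP : L ^ m ∣ P) (hreg : ∀ z, RegularPrimePer L (U z) η m a Λs P)
    (hb : ∀ z, Function.Bijective (qggqPer (𝔸 := 𝔸) (d := d) P L (U z) η m a Λs)) {F : Z → perSub (𝔸 := 𝔸) (d := d) P} (hF : ContinuousAt F z₀) :
    ContinuousAt (fun z => RopPer P L (U z) η m a Λs (F z)) z₀ := by
  unfold RopPer
  exact hF.sub (continuousAt_GpPer hU hbgT η a hreg (continuousAt_QprimeStarPer hbgT (continuousAt_cPer hU hbgT η a hP hreg hb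
    (continuousAt_QprimeVecPer hbgT (continuousAt_GpPer hU hbgT η a hreg hF)))))

end Letters

/-! ## §2  The record's `R(U)` on the torus is continuous in the background on Hermitian inputs -/

section Projection

variable (τ : 𝔸 →ₗ[ℂ] ℂ) {P L : ℕ} [NeZero P] [NeZero L] {m : ℕ} {Λs : ℕ → Set (Site d)} (η : ℝ) (a : ℕ → ℝ) [FiniteDimensional ℝ 𝔸]
  {U : Z → Site d → Fin d → 𝔸ˣ} (hU : ContinuousAt U z₀)
  (hbgT : ∀ j, j < m + 1 → ∀ (y x : Site d), ContinuousAt (fun z => bgT L (U z) j y x) z₀)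

include hU hbgT in
/-- ★★★ **THE RECORD's LANDAU PROJECTION `R(U)` ON `L²(T_P, 𝔤)`, APPLIED TO A CONTINUOUS PERIODIC HERMITIAN FAMILY, IS CONTINUOUS IN THE BACKGROUND** — along any
family of UNITARY `P`-periodic backgrounds with unitary averaged transporters (`j ≤ m`), `L ≥ 1`, `Lᵐ ∣ P`, level-periodic `Λ_j`, in the regime (`Δ′_a(U_z)` invertible,
`Q′*` injective — e.g. the weights `a ≥ 0` with an active level), faithful Hermitian tracial `τ`, finite-dimensional fibre: for `g_z` `P`-periodic, Hermitian-valued, with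
continuous site values, `z ↦ (R(U_z)g_z)(x)` is continuous at `z₀`.  On Hermitian inputs `R(U)` IS (3.25) (`B9Eq325ProjFormulaZdPer`), continuous by §1.
[cite: Balaban1985BackgroundPropagators, (3.21)–(3.22) p.394, (3.25) p.394; Balaban1985RegularSpaces, p.77 («Ω_j = T_η»)] -/
theorem continuousAt_projRPer_of_herm (hτt : ∀ a b : 𝔸, τ (a * b) = τ (b * a)) (hτs : ∀ a : 𝔸, τ (star a) = starRingEnd ℂ (τ a))
    (hτp : ∀ a : 𝔸, a ≠ 0 → 0 < (τ (star a * a)).re) (hL : 1 ≤ L)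
    (hUu : ∀ (z : Z) (x : Site d) (κ : Fin d), U z x κ ∈ unitaryUnits 𝔸) (hT : ∀ (z : Z) (j : ℕ) (x y : Site d), bgT L (U z) j x y ∈ unitaryUnits 𝔸)
    (hUper : ∀ z, IsPeriodic P (U z)) (hP : L ^ m ∣ P) (hΛ : ∀ j, j ≤ m → IsPeriodic (P / L ^ j) fun y => y ∈ Λs j)
    (hreg : ∀ z, RegularPrimePer L (U z) η m a Λs P) (hinj : ∀ z, QprimeStarPerInjective (𝔸 := 𝔸) (d := d) P L (U z) m Λs)
    {g : Z → Site d → 𝔸} (hg : ∀ x : Site d, ContinuousAt (fun z => g z x) z₀) (hgper : ∀ z, IsPeriodic P (g z))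
    (hherm : ∀ (z : Z) (x : Site d), IsSelfAdjoint (g z x)) (x : Site d) :
    ContinuousAt (fun z => projRPer τ P L m η Λs (U z) (g z) x) z₀ := by
  have hb : ∀ z, Function.Bijective (qggqPer (𝔸 := 𝔸) (d := d) P L (U z) η m a Λs) :=
    fun z => qggqPer_bijective τ hτt hτs hτp (hUu z) (hT z) (hUper z) hP (hreg z) (hinj z)
  -- the family in `L²(T_P, ·)`
  let F : Z → perSub (𝔸 := 𝔸) (d := d) P := fun z => ⟨g z, hgper z⟩
  have hF : ContinuousAt F z₀ := by
    rw [continuousAt_perSub_iff]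
    exact hg
  have hR := continuousAt_RopPer (hU := hU) (hbgT := hbgT) η a hP hreg hb hF
  have hRx : ContinuousAt (fun z => ((RopPer P L (U z) η m a Λs (F z) : perSub (𝔸 := 𝔸) (d := d) P) : Site d → 𝔸) x) z₀ :=
    continuousAt_perSub_iff.1 hR x
  refine hRx.congr (Eventually.of_forall fun z => ?_)
  show _ = projRPer τ P L m η Λs (U z) (g z) x
  rw [coe_projRPer_eq_RopPer_of_herm τ hτt hτs hτp hL (hUu z) (hT z) (hUper z) hP hΛ (hreg z) (hinj z) (hgper z) (hherm z) (a := a)]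

include hU hbgT in
/-- **THE `DRD*` LETTER ON THE TORUS IS CONTINUOUS IN THE BACKGROUND**: for a periodic Hermitian bond field `A` (so that `D^{η*}_UA` is periodic and Hermitian at unitary
periodic `U`), `z ↦ (D^η_{U_z,μ} R(U_z) D^{η*}_{U_z} A)(x)` is continuous at `z₀` under the hypotheses of `continuousAt_projRPer_of_herm` — the letter `DRDs` of the genuine
periodic record. [cite: Balaban1985BackgroundPropagators, (3.26) p.395 («D^η_U R(U) D^{η*}_U»), (3.25) p.394] -/
theorem continuousAt_covDerivFwd_projRPer_covDivB (hτt : ∀ a b : 𝔸, τ (a * b) = τ (b * a)) (hτs : ∀ a : 𝔸, τ (star a) = starRingEnd ℂ (τ a))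
    (hτp : ∀ a : 𝔸, a ≠ 0 → 0 < (τ (star a * a)).re) (hL : 1 ≤ L)
    (hUu : ∀ (z : Z) (x : Site d) (κ : Fin d), U z x κ ∈ unitaryUnits 𝔸) (hT : ∀ (z : Z) (j : ℕ) (x y : Site d), bgT L (U z) j x y ∈ unitaryUnits 𝔸)
    (hUper : ∀ z, IsPeriodic P (U z)) (hP : L ^ m ∣ P) (hΛ : ∀ j, j ≤ m → IsPeriodic (P / L ^ j) fun y => y ∈ Λs j)
    (hreg : ∀ z, RegularPrimePer L (U z) η m a Λs P) (hinj : ∀ z, QprimeStarPerInjective (𝔸 := 𝔸) (d := d) P L (U z) m Λs)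
    {A : Site d → Fin d → 𝔸} (hA : IsPeriodic P A) (hAh : ∀ (y : Site d) (μ : Fin d), IsSelfAdjoint (A y μ)) (μ : Fin d) (x : Site d) :
    ContinuousAt (fun z => covDerivFwd η (U z) μ (projRPer τ P L m η Λs (U z) (covDivB η (U z) A)) x) z₀ := by
  have hproj : ∀ y : Site d, ContinuousAt (fun z => projRPer τ P L m η Λs (U z) (covDivB η (U z) A) y) z₀ := by
    intro y
    refine continuousAt_projRPer_of_herm τ η a hU hbgT hτt hτs hτp hL hUu hT hUper hP hΛ hreg hinj (g := fun z => covDivB η (U z) A)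
      (fun x' => continuousAt_covDivB hU η x' fun _ _ => continuousAt_const) (fun z => B9Eq321LandauProjectionZdPer.isPeriodic_covDivB (hUper z) hA)
      (fun z x' => B9Eq325ProjContinuityZd.isSelfAdjoint_covDivB η (hUu z) hAh x') y
  exact continuousAt_covDerivFwd hU η μ x (hproj _) (hproj x)

end Projection

end Literature.MathematicalPhysics.QuantumFieldTheory.Balaban1983to89.B9Eq325ProjContinuityZdPer

end
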